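import Literature.NumberTheory.EllipticCurves.Kato2004.IwasawaH1ReductionKernel
import Literature.NumberTheory.GaloisRepresentations.ContinuousCorestriction
import Literature.NumberTheory.GaloisRepresentations.ConjugationDescent
import HarnessLib

/-!
# Kato 2004 (Astérisque 295) Lemma 8.5 (2), tools I: universal norms without weights

Topic `NumberTheory/EllipticCurves`, sub-directory `Kato2004` (namespace = path, sub-namespace
`UniversalNorms`).  Cell `bsd-smallim` (rung K6 of `BirchSwinnertonDyer`), seat `bsd-smallim-k6-lur-a`
(gen 3).  THEOREMS ONLY (no definition, no named fact, no `sorry`).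

This is the first of the files discharging the named fact
`Kato2004.mem_integralH1_of_forall_layerCores_eq` (`IwasawaH1NormCompatibleIntegral.lean`: Kato's
Lemma 8.5 (2) read on the layers of the cyclotomic `ℤ_p`-extension for `T = T_pW` — every
norm-compatible family `z_n ∈ H¹(ℚ_n, T_pW)` is integral, WITHOUT the hypothesis "`p • z_n` integral" of
the weak form `UniversalNorms.mem_integralH1_of_layerCores_eq_of_smul_mem` of the `Summits` tree).  The
weight argument of the printed proof ("`H⁰(𝔽_v(ζ_{p^∞}), H¹(K_v^{ur}, T)) `has no universal norms",
Kato p. 184, Rubin B.3.3) is replaced by: universal norms of a Frobenius power in `M = H¹(I_𝔓, T_pW)` lie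
in `p^m M` for every `m` (a pigeonhole in the FINITE module `M/p^m M`), and `⋂_m p^m M = 0`.  This file
provides the three generic tools:

* §1 `sum_range_pow_eq_zero_of_periodic_of_pow_smul` — a `p^k`-periodic, shift-deterministic sequence of
  `p^m`-torsion elements with values in a finite set `S`, `#S · p^m ≤ p^k`, sums to `0` over `i < p^k`
  (pigeonhole: least period `p^b ≤ #S`, so the sum is `p^(k-b) • (…)` with `k - b ≥ m`).
* §2 `exists_resLe_conjMap_eq_smul` — transport of divisibility under conjugation: if
  `res_{I'} y = r • c` then `res_I (g · y) = r • c'` whenever `g⁻¹ I g ⊆ I'` (the class `c'` is the pull-back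
  of `c` along `(s ↦ g⁻¹ s g, v ↦ g v)`); and `resLe_injective_of_le` — restriction between two subgroups
  with the same elements is injective.
* §3 `TateModule.tendsto_pow_smul_atTop` (`p^m • y_m → 0` in `T_p A`) and
  `eq_zero_of_forall_exists_pow_smul_eq` — **`⋂_m p^m H¹(I, T_pW) = 0`** for every subgroup `I ≤ Γ_ℚ`:
  if `φ = p^m φ_m + ∂t_m` for all `m`, a cluster point `t` of `(t_m)` in the COMPACT module `T_pW`
  satisfies `φ = ∂t` (`p^m φ_m(g) → 0`, `T_pW` Hausdorff).

References: K. Kato, Astérisque 295 (2004), §8.2, Lemma 8.5 (pp. 180–184) [Kato2004Asterisque];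
K. Rubin, *Euler Systems* (2000), App. B, Prop. B.2.3, B.3.3 [Rubin2000]; J.-P. Serre, *Galois
Cohomology* (1997), I §2.2–2.5 [SerreGaloisCohomology1997]; J.-P. Serre, *Abelian ℓ-adic representations*
(1968), I §1.1 [Serre1968].
-/

noncomputable section

open scoped NumberField
open CategoryTheory Field Filter Topology
open Literature.NumberTheory.GaloisRepresentations
open Literature.NumberTheory.EllipticCurves
open Literature.NumberTheory.EllipticCurves.Kato2004
open Literature.NumberTheory.EllipticCurves.Kato2004.EulerSystemValues

universe u v

namespace Literature.NumberTheory.EllipticCurves.Kato2004.UniversalNorms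

/-! ## §1 A periodic shift-deterministic sequence of `p^m`-torsion elements in a small set sums to zero -/

section Periodic

variable {B : Type*} [AddCommMonoid B]

omit [AddCommMonoid B] in
/-- A `Q`-periodic sequence is `c * Q`-periodic. [folklore] -/
private theorem periodic_mul {a : ℕ → B} {Q : ℕ} (hQ : ∀ s, a (s + Q) = a s) (c : ℕ) :
    ∀ s, a (s + c * Q) = a s := by
  induction c with
  | zero => intro s; rw [zero_mul, add_zero]
  | succ c ih => intro s; rw [Nat.succ_mul, ← add_assoc, hQ, ih]

/-- The sum of a `Q`-periodic sequence over `c` periods is `c •` the sum over one period. [folklore] -/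
private theorem sum_range_mul_eq_smul_of_periodic {a : ℕ → B} {Q : ℕ} (hQ : ∀ s, a (s + Q) = a s)
    (c : ℕ) : ∑ i ∈ Finset.range (c * Q), a i = c • ∑ i ∈ Finset.range Q, a i := by
  induction c with
  | zero => rw [zero_mul, Finset.range_zero, Finset.sum_empty, zero_smul]
  | succ c ih =>
    rw [Nat.succ_mul, Finset.sum_range_add, ih, succ_nsmul]
    congr 1
    refine Finset.sum_congr rfl fun i _ => ?_
    rw [add_comm, periodic_mul hQ c i]

/-- **Periodicity lemma, `p^m`-torsion form.**  Let `a : ℕ → B` take values in a finite set `S` with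
`#S · p^m ≤ p^k`, be `p^k`-periodic and SHIFT-DETERMINISTIC (`a i = a j → a (i+1) = a (j+1)`), and consist
of `p^m`-torsion elements.  Then `∑_{i < p^k} a i = 0`: by pigeonhole `a` has a period `d ≤ #S`, the least
period `g` divides `p^k`, so `g = p^b` with `p^b ≤ #S`, whence `b + m ≤ k` and the sum is
`p^(k-b-m) • p^m • ∑_{i<g} a i = 0`.  (The counting step replacing "`cd_p = 0` ⇒ no universal norms"
in the proof of Lemma 8.5 (2), in the form used by `UniversalNormsIntegralProofs`.)
[cite: Kato2004Asterisque, Lemma 8.5 (2) (p. 184), proof] -/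
theorem sum_range_pow_eq_zero_of_periodic_of_pow_smul {p : ℕ} (hp : p.Prime) (a : ℕ → B)
    {S : Finset B} (haS : ∀ i, a i ∈ S) {k m : ℕ} (hcard : S.card * p ^ m ≤ p ^ k)
    (hper : ∀ i, a (i + p ^ k) = a i) (hdet : ∀ i j, a i = a j → a (i + 1) = a (j + 1))
    (htor : ∀ i, p ^ m • a i = 0) :
    ∑ i ∈ Finset.range (p ^ k), a i = 0 := by
  classical
  -- pigeonhole: `a i = a j` for some `i < j ≤ #S`
  obtain ⟨i, hi, j, hj, hij, hija⟩ := Finset.exists_ne_map_eq_of_card_lt_of_maps_to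
    (s := Finset.range (S.card + 1)) (t := S) (f := a) (by simp) (fun x _ => haS x)
  wlog hlt : i < j generalizing i j
  · exact this j hj i hi hij.symm hija.symm (lt_of_le_of_ne (not_lt.mp hlt) hij.symm)
  have hshift : ∀ t, a (i + t) = a (j + t) := by
    intro t
    induction t with
    | zero => simpa using hija
    | succ t ih => rw [← add_assoc, ← add_assoc]; exact hdet _ _ ih
  -- the period `d = j - i ≤ #S`
  set d := j - i with hd
  have hdpos : 0 < d := by omega
  have hdle : d ≤ S.card := by
    have : j ≤ S.card := by simpa [Finset.mem_range, Nat.lt_succ_iff] using hj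
    omega
  have hperL : ∀ L s, a (s + L * p ^ k) = a s := fun L => periodic_mul hper L
  have hdper : ∀ s, a (s + d) = a s := by
    intro s
    have hk1 : 1 ≤ p ^ k := Nat.one_le_pow _ _ hp.pos
    obtain ⟨Q, hQ⟩ : ∃ Q, p ^ k = Q + 1 := ⟨p ^ k - 1, by omega⟩
    have e1 : s + d + i * p ^ k = j + (s + i * Q) := by
      rw [hQ, mul_add, mul_one]; omega
    have e2 : i + (s + i * Q) = s + i * p ^ k := by
      rw [hQ, mul_add, mul_one]; omega
    rw [← hperL i (s + d), e1, ← hshift, e2, hperL]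
  -- the least positive period `g` divides every period
  have hex : ∃ e, 0 < e ∧ ∀ s, a (s + e) = a s := ⟨d, hdpos, hdper⟩
  set g := Nat.find hex with hg
  have hgper : ∀ s, a (s + g) = a s := (Nat.find_spec hex).2
  have hgpos : 0 < g := (Nat.find_spec hex).1
  have hgle : g ≤ d := Nat.find_min' hex ⟨hdpos, hdper⟩
  have hgdvd : ∀ e, (∀ s, a (s + e) = a s) → g ∣ e := by
    intro e
    induction e using Nat.strong_induction_on with
    | _ e ih =>
      intro he
      rcases Nat.eq_zero_or_pos e with rfl | hepos
      · exact dvd_zero _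
      by_cases hlt : e < g
      · exact absurd ⟨hepos, he⟩ (Nat.find_min hex hlt)
      · have hge : g ≤ e := not_lt.mp hlt
        have he' : ∀ s, a (s + (e - g)) = a s := fun s => by
          rw [← hgper (s + (e - g)), add_assoc, Nat.sub_add_cancel hge, he]
        have := ih (e - g) (by omega) he'
        have heq : e = (e - g) + g := (Nat.sub_add_cancel hge).symm
        rw [heq]
        exact dvd_add this (dvd_refl g)
  -- `g = p ^ b` with `p ^ b ≤ #S`, hence `b + m ≤ k`
  obtain ⟨b, hbk, hgb⟩ := (Nat.dvd_prime_pow hp).mp (hgdvd (p ^ k) hper)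
  have hbm : b + m ≤ k := by
    have h1 : p ^ (b + m) ≤ p ^ k := by
      rw [pow_add, ← hgb]
      exact le_trans (Nat.mul_le_mul_right _ (hgle.trans hdle)) hcard
    exact (Nat.pow_le_pow_iff_right hp.one_lt).mp h1
  -- `p ^ k = (p ^ (k - b - m) * p ^ m) * g`
  have hk : p ^ k = (p ^ (k - b - m) * p ^ m) * g := by
    rw [hgb, ← pow_add, ← pow_add]
    congr 1
    omega
  rw [hk, sum_range_mul_eq_smul_of_periodic hgper, mul_smul, Finset.smul_sum, Finset.smul_sum]
  refine Finset.sum_eq_zero fun x _ => ?_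
  rw [htor x, smul_zero]

end Periodic

/-! ## §2 Restriction, conjugation and divisibility -/

section Conj

variable {R : Type v} [CommRing R] [TopologicalSpace R]
variable {G : Type u} [Group G] [TopologicalSpace G] [IsTopologicalGroup G]
variable (X : TopRep.{u} R G) (H : Subgroup G)

/-- **Conjugation transports divisibility between restrictions.**  Let `H ⊴ G`, `g ∈ G`, and
`I, I' ≤ H` with `g⁻¹ I g ⊆ I'`.  If `res_{I'} y = r • c` for a class `y ∈ H¹(H, X)`, then
`res_I (g · y) = r • c'` for some `c' ∈ H¹(I, X)`: writing `φ|_{I'} = r ψ + ∂w`, one has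
`(g·φ)(s) = g φ(g⁻¹sg) = r · g ψ(g⁻¹ s g) + s (g w) − g w`, and `s ↦ g ψ(g⁻¹ s g)` is the continuous
cocycle on `I` pulled back from `ψ` along the compatible pair `(s ↦ g⁻¹sg, v ↦ g v)`.  (For `r = 0` this is
the tree's `Derivative.resLe_conjMap_eq_zero`.) [cite: SerreGaloisCohomology1997, I §2.4–2.5] -/
theorem exists_resLe_conjMap_eq_smul [H.Normal] (g : G) {I I' : Subgroup G} (hIH : I ≤ H)
    (hI'H : I' ≤ H) (hI' : ∀ s ∈ I, g⁻¹ * s * g ∈ I') (r : R)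
    {y : continuousCohomology 1 (subgroupRep X H)} {c : continuousCohomology 1 (subgroupRep X I')}
    (hy : resLe X hI'H 1 y = r • c) :
    ∃ c' : continuousCohomology 1 (subgroupRep X I), resLe X hIH 1 (conjMap X H g 1 y) = r • c' := by
  obtain ⟨φ, rfl⟩ := oneCocycleClass_surjective _ y
  obtain ⟨ψ, rfl⟩ := oneCocycleClass_surjective _ c
  -- `φ|_{I'} - r ψ = ∂ w`
  have h0 : oneCocycleClass (subgroupRep X I')
      (contOneCocycles.pullback (subgroupInclusion hI'H) (X := subgroupRep X H) (Y := subgroupRep X I')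
        (TopRep.ofHom ⟨ContinuousLinearMap.id R X, fun _ => rfl⟩) φ - r • ψ) = 0 := by
    rw [oneCocycleClass_sub, oneCocycleClass_smul, ← resLe_oneCocycleClass, hy, sub_self]
  obtain ⟨w, hw⟩ := (oneCocycleClass_eq_zero_iff _ _).mp h0
  -- the conjugation `θ : I → I'`, `s ↦ g⁻¹ s g`, and the module map `v ↦ g v`
  let θ : I →ₜ* I' :=
    { toFun := fun s => ⟨g⁻¹ * (s : G) * g, hI' s s.2⟩
      map_one' := Subtype.ext (by simp)
      map_mul' := fun x y => Subtype.ext (by simp [mul_assoc])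
      continuous_toFun := Continuous.subtype_mk
        ((continuous_const.mul continuous_subtype_val).mul continuous_const) _ }
  have hθ : ∀ s : I, ((θ s : I') : G) = g⁻¹ * (s : G) * g := fun _ => rfl
  let f : TopRep.res (θ : I →* I') (subgroupRep X I') ⟶ subgroupRep X I :=
    TopRep.ofHom ⟨X.ρ g, fun s => by
      ext v
      change X.ρ g (X.ρ (g⁻¹ * (s : G) * g) v) = X.ρ (s : G) (X.ρ g v)
      rw [mul_assoc, ρ_mul_apply, ρ_apply_ρ_inv_apply, ρ_mul_apply]⟩
  refine ⟨oneCocycleClass _ (contOneCocycles.pullback θ f ψ), ?_⟩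
  rw [conjMap_oneCocycleClass, resLe_oneCocycleClass, ← oneCocycleClass_smul, ← sub_eq_zero,
    ← oneCocycleClass_sub, oneCocycleClass_eq_zero_iff]
  refine ⟨X.ρ g w, fun s => ?_⟩
  have hws := hw (θ s)
  change φ.1 (subgroupInclusion hI'H (θ s)) - r • ψ.1 (θ s) = X.ρ ((θ s : I') : G) w - w at hws
  change X.ρ g (φ.1 (subgroupConj H g (subgroupInclusion hIH s))) - r • X.ρ g (ψ.1 (θ s)) =
    X.ρ (s : G) (X.ρ g w) - X.ρ g w
  have hconj : subgroupConj H g (subgroupInclusion hIH s) = subgroupInclusion hI'H (θ s) :=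
    Subtype.ext (by rw [subgroupConj_apply_coe, subgroupInclusion_apply_coe, subgroupInclusion_apply_coe,
      hθ])
  rw [hconj, ← map_smul, ← map_sub, hws, hθ, map_sub, ← ρ_mul_apply, ← ρ_mul_apply,
    show g * (g⁻¹ * (s : G) * g) = (s : G) * g by group]

/-- **Restriction between subgroups with the same elements is injective**: for `I ≤ J` with `J ≤ I`,
`res : H¹(J, X) → H¹(I, X)` is injective (a cocycle on `J` which is a coboundary on `I` is a coboundary).
[cite: SerreGaloisCohomology1997, I §2.4] -/
theorem resLe_injective_of_le {I J : Subgroup G} (h : I ≤ J) (h' : J ≤ I) :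
    Function.Injective (resLe X h 1) := by
  have key : ∀ x : continuousCohomology 1 (subgroupRep X J), resLe X h 1 x = 0 → x = 0 := by
    intro x hx
    obtain ⟨φ, rfl⟩ := oneCocycleClass_surjective _ x
    rw [resLe_oneCocycleClass, oneCocycleClass_eq_zero_iff] at hx
    obtain ⟨w, hw⟩ := hx
    rw [oneCocycleClass_eq_zero_iff]
    refine ⟨w, fun t => ?_⟩
    have ht := hw ⟨(t : G), h' t.2⟩
    rw [contOneCocycles.pullback_apply, TopRep.hom_ofHom] at ht
    have e : subgroupInclusion h ⟨(t : G), h' t.2⟩ = t := Subtype.ext rfl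
    rw [e] at ht
    exact ht
  intro a b hab
  have h0 : resLe X h 1 (a - b) = 0 := by rw [map_sub, hab, sub_self]
  exact sub_eq_zero.mp (key _ h0)

end Conj

/-! ## §3 `p^m • y_m → 0` in `T_p A`, and `⋂_m p^m H¹(I, T_pW) = 0` -/

section Separated

/-- In `T_p A` (coordinates `a_n ∈ A[p^n]`, product topology from the discrete `A`), `p^m • y_m → 0`
for EVERY sequence `(y_m)`: the `n`-th coordinate of `p^m • y` is `(p^m mod p^n) • y_n = 0` once
`m ≥ n`. [cite: Serre1968, Ch. I §1.1] -/
theorem _root_.Literature.NumberTheory.EllipticCurves.TateModule.tendsto_pow_smul_atTop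
    {A : Type u} [AddCommGroup A] [TopologicalSpace A] [DiscreteTopology A] {p : ℕ} [Fact p.Prime]
    (y : ℕ → TateModule A p) :
    Tendsto (fun m => ((p : ℤ_[p]) ^ m) • y m) atTop (𝓝 0) := by
  have hind : Topology.IsInducing (fun a : TateModule A p => (a.1 : ℕ → A)) :=
    Topology.IsInducing.subtypeVal
  rw [hind.tendsto_nhds_iff]
  refine tendsto_pi_nhds.mpr fun n => ?_
  change Tendsto (fun m => TateModule.proj p n (((p : ℤ_[p]) ^ m) • y m)) atTop
    (𝓝 (TateModule.proj p n (0 : TateModule A p)))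
  rw [map_zero]
  refine tendsto_atTop_of_eventually_const (i₀ := n) fun m hm => ?_
  rw [TateModule.proj_smul, map_pow, map_natCast]
  have h0 : ((p : ZMod (p ^ n)) ^ m) = 0 := by
    rw [← Nat.cast_pow, ZMod.natCast_eq_zero_iff]
    exact pow_dvd_pow p hm
  rw [h0, ZMod.val_zero, zero_smul]

variable (W : WeierstrassCurve ℚ) [W.IsElliptic] (p : ℕ) [Fact p.Prime]
  [ContinuousSMul ℤ_[p] (W.tateModule p)]

/-- **`⋂_m p^m H¹(I, T_pW) = 0`** for every subgroup `I ≤ Γ_ℚ`: a class divisible by every power of `p`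
vanishes.  PROOF: write `c = [φ]` and `φ = p^m φ_m + ∂t_m` for all `m`; `T_pW` is compact (a finitely
generated `ℤ_p`-module with its module topology, `TateModule.isModuleTopology`), so `(t_m)` has a cluster
point `t`; for fixed `g`, `g t_m − t_m = φ(g) − p^m φ_m(g) → φ(g)` (`tendsto_pow_smul_atTop`), and
`s ↦ g s − s` is continuous, so `g t − t` is a cluster point of a sequence converging to `φ(g)` in the
Hausdorff space `T_pW`, i.e. `φ(g) = g t − t`.  (Kato §8.2: `H^q(R, T) = lim←_n H^q(R, T/p^n)`; Rubin
B.2.3.) [cite: Kato2004Asterisque, §8.2 (p. 180)] [cite: Rubin2000, App. B Prop. B.2.3] -/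
theorem eq_zero_of_forall_exists_pow_smul_eq (I : Subgroup (absoluteGaloisGroup ℚ))
    (c : H1 (tateRep W p) I)
    (hc : ∀ m : ℕ, ∃ c' : H1 (tateRep W p) I, ((p : ℤ_[p]) ^ m) • c' = c) : c = 0 := by
  classical
  obtain ⟨φ, rfl⟩ := oneCocycleClass_surjective (subgroupRep (tateRep W p).toTopRep I) c
  -- `φ - p^m φ_m = ∂ t_m`
  have hm : ∀ m : ℕ, ∃ (φm : contOneCocycles (subgroupRep (tateRep W p).toTopRep I))
      (t : W.tateModule p), ∀ g, φ.1 g - ((p : ℤ_[p]) ^ m) • φm.1 g =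
        (subgroupRep (tateRep W p).toTopRep I).ρ g t - t := by
    intro m
    obtain ⟨c', hc'⟩ := hc m
    obtain ⟨φm, rfl⟩ := oneCocycleClass_surjective _ c'
    have h0 : oneCocycleClass (subgroupRep (tateRep W p).toTopRep I)
        (φ - ((p : ℤ_[p]) ^ m) • φm) = 0 := by
      rw [oneCocycleClass_sub, oneCocycleClass_smul, hc', sub_self]
    obtain ⟨t, ht⟩ := (oneCocycleClass_eq_zero_iff _ _).mp h0
    refine ⟨φm, t, fun g => ?_⟩
    have := ht g
    rwa [Submodule.coe_sub, ContinuousMap.sub_apply, Submodule.coe_smul, ContinuousMap.smul_apply] at this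
  choose φm t ht using hm
  -- `T_pW` is compact Hausdorff
  haveI : Module.Finite ℤ_[p] (W.tateModule p) := WeierstrassCurve.module_finite_tateModule_holds W p
  haveI : IsModuleTopology ℤ_[p] (W.tateModule p) := TateModule.isModuleTopology
  haveI : CompactSpace (W.tateModule p) := by
    have h := compactSpace_moduleTopology_of_finite ℤ_[p] (W.tateModule p)
    rwa [← eq_moduleTopology ℤ_[p] (W.tateModule p)] at h
  haveI : T2Space (W.tateModule p) := TateModule.t2Space
  obtain ⟨t₀, -, ht₀⟩ := isCompact_univ.exists_mapClusterPt (f := atTop) (u := t)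
    (le_principal_iff.mpr univ_mem)
  rw [oneCocycleClass_eq_zero_iff]
  refine ⟨t₀, fun g => ?_⟩
  -- work in `T_pW` with its own (product) topology; the action of `g` is `s ↦ g • s`
  haveI : ContinuousConstSMul (absoluteGaloisGroup ℚ) (WeierstrassCurve.geomPoints W) :=
    ⟨fun _ => continuous_of_discreteTopology⟩
  have hF : Continuous fun s : W.tateModule p => ((g : absoluteGaloisGroup ℚ)) • s - s :=
    (continuous_const_smul _).sub continuous_id
  have h1 : MapClusterPt (((g : absoluteGaloisGroup ℚ)) • t₀ - t₀) atTop
      ((fun s : W.tateModule p => ((g : absoluteGaloisGroup ℚ)) • s - s) ∘ t) :=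
    ht₀.continuousAt_comp hF.continuousAt
  have h3 := TateModule.tendsto_pow_smul_atTop (A := WeierstrassCurve.geomPoints W) (p := p)
    (fun m => ((φm m).1 g : W.tateModule p))
  have h5 : Tendsto (fun m => (φ.1 g : W.tateModule p) - ((p : ℤ_[p]) ^ m) • ((φm m).1 g : W.tateModule p))
      atTop (𝓝 ((φ.1 g : W.tateModule p) - 0)) :=
    (tendsto_const_nhds (x := (φ.1 g : W.tateModule p)) (f := (atTop : Filter ℕ))).sub h3
  rw [sub_zero] at h5
  have e : ((fun s : W.tateModule p => ((g : absoluteGaloisGroup ℚ)) • s - s) ∘ t) =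
      fun m => (φ.1 g : W.tateModule p) - ((p : ℤ_[p]) ^ m) • ((φm m).1 g : W.tateModule p) := by
    funext m
    have hmg : (φ.1 g : W.tateModule p) - ((p : ℤ_[p]) ^ m) • ((φm m).1 g : W.tateModule p) =
        ((g : absoluteGaloisGroup ℚ)) • t m - t m := ht m g
    exact hmg.symm
  rw [e] at h1
  have h4 : ClusterPt (((g : absoluteGaloisGroup ℚ)) • t₀ - t₀) (𝓝 (φ.1 g : W.tateModule p)) :=
    h1.clusterPt.mono h5
  change (φ.1 g : W.tateModule p) = ((g : absoluteGaloisGroup ℚ)) • t₀ - t₀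
  exact (eq_of_nhds_neBot h4.neBot).symm

end Separated

end Literature.NumberTheory.EllipticCurves.Kato2004.UniversalNorms

end
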